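import Mathlib
import Summits.CriticalPhenomena.CardyFormulaZ2.Theorems.CardyMagicRigidityNestingRigidityConeTiltLoopSide
import Summits.CriticalPhenomena.CardyFormulaZ2.Theorems.CardyMagicRigidityNestingRigidityFusionBaseCases
import Summits.CriticalPhenomena.CardyFormulaZ2.Theorems.CardyMagicRigidityNestingRigidityInterfaceLoopCylinder
import Summits.CriticalPhenomena.CardyFormulaZ2.Theorems.CardyMagicRigidityNestingRigidityOneGenerationZ2Indep
import Summits.CriticalPhenomena.CardyFormulaZ2.Theorems.CardyMagicRigidityNestingRigidityOneGenerationTLocality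
import HarnessLib

/-!
# Crux `NestingRigidity`, line `ring-cloud-tomography` (r4): independence of tower counts across
# disjoint annuli and exact sub- and super-multiplicativity of tower moments, on BOTH lattices

Crux `Summit.CriticalPhenomena.CardyFormulaZ2.Theses.CardyMagicRigidity.NestingRigidity`
(stmt-CriticalPhenomena-4835), line `ring-cloud-tomography`, skeleton r4, stub R1'
`stub_uvDecoupling : ∀ E ∈ latticeEnsembles, UVDecoupling E` (separation of scales behind the cone law,
`coneTiltLaw_of_cloudLaw`).  Of its three lattice inputs — (I) quasi-multiplicativity of positively
weighted tower functionals, (II) concentration of the UV drift, (III) the first-moment identity — this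
file lands the EXACT half of (I), sorry-free, over the tree's own objects:

* §1 **bond-`ℤ²` cylinder property of towers.**  The loops of `X_δ(ω)` surrounding `B̄(x, ρ)` inside
  `B(x, R)` (counted by `towerCount (zEns.X δ ω) x ρ R`) read the configuration ONLY through the edges
  whose medial point lies in the open annulus `B(x, R) ∖ B̄(x, ρ)` (an interface loop is a cylinder event
  on its own entries, `isInterfaceLoop_congr`; midpoints are on the trace, `mem_range_loopCurve`; the
  trace lies in the window and carries winding number `0`).  Hence (product measure, `indep_coord`) tower
  counts of windows with DISJOINT midpoint annuli are independent under `zEns.P`, at every mesh, with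
  no margin (`indepFun_towerCount_zEns`);
* §2 **site-`𝕋`**: the same family reads only the sites drawn in the thickened annulus
  `B(x, R + δ) ∖ B̄(x, ρ − δ)` (`isSiteInterfaceLoop_congr_of_darts`, `hexCenter_triEdgeFaces_mem_closedBall`),
  whence independence for windows with disjoint thickened annuli under `tEns.P` (`indepFun_of_determined`);
* §3 **both lattices** (registered anchor `indepFun_towerCount_latticeEnsembles`), in particular for
  concentric nested annuli with a `2δ` gap (`indepFun_towerCount_nested`: `R' + 2δ ≤ ρ`);
* §4 **exact sub- and super-multiplicativity of tower moments** from the super-additivity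
  `N_0(ρ₁,1) + N_0(ρ₁ρ₂,ρ₁) ≤ N_0(ρ₁ρ₂,1)` (`ConeTilt.towerCount_add_le_latticeEnsembles`), window
  monotonicity and §3: `E.towerMoment u δ (ρ₁ρ₂) ≤ E.towerMoment u δ ρ₁ · E_δ[u^{N_0(ρ₁ρ₂, ρ₁')}]` for
  `0 ≤ u ≤ 1` and the reverse inequality for `1 ≤ u`, whenever `ρ₁' + 2δ ≤ ρ₁`.

What remains of (I) is the RSW LOWER bound (quasi-multiplicativity proper); (II), (III) are not
asserted here.
-/
noncomputable section

open MeasureTheory ProbabilityTheory Set Filter Metric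
open scoped Real Topology BigOperators

namespace Summit.CriticalPhenomena.CardyFormulaZ2.Cruxes.NestingRigidity.RingCloudTomography

open Literature.Probability.RandomPlanarGeometry Literature.Probability.Percolation
  Literature.Probability.LatticeModels
open Summit.CriticalPhenomena.CardyFormulaZ2.Cruxes.NestingRigidity.MarkovCascadeOneGeneration
  (isInterfaceLoop_congr isSiteInterfaceLoop_congr_of_darts indep_coord measurable_inter_coord
    indepFun_of_determined measurable_inter_of_subset)

namespace TowerIndependence

/-! ## §1 Bond-`ℤ²`: the tower of a window reads only the edges with midpoint in the window annulus -/

/-- The entries of a nonempty dart list whose drawn loop (mesh `δ`) surrounds `B̄(x, ρ)` and has trace in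
`B(x, R)` have their medial points in the open annulus `B(x, R) ∖ B̄(x, ρ)`: the medial point is on the
trace, the trace lies in the window, and the loop does not wind around its own trace. -/
theorem medialPoint_mem_of_tower {δ : ℝ} {γ : List MedialVertex} (hγ : γ ≠ []) {x : ℂ} {ρ R : ℝ}
    (hwind : closedBall x ρ ⊆
      {z | (UnbasedLoop.mk (BasedLoop.mk (loopCurve δ 0 γ) (isLoop_loopCurve δ 0 hγ))).wind z ≠ 0})
    (hrange : (UnbasedLoop.mk (BasedLoop.mk (loopCurve δ 0 γ) (isLoop_loopCurve δ 0 hγ))).range ⊆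
      ball x R)
    {e : MedialVertex} (he : e ∈ γ) : medialPoint δ e ∈ ball x R \ closedBall x ρ := by
  have hmem : medialPoint δ e ∈
      (UnbasedLoop.mk (BasedLoop.mk (loopCurve δ 0 γ) (isLoop_loopCurve δ 0 hγ))).range := by
    rw [UnbasedLoop.range_mk, BasedLoop.toCurveClass_mk]
    simpa [Circle.exp_zero] using mem_range_loopCurve δ 0 he
  exact ⟨hrange hmem, fun h ↦ hwind h (unbasedLoop_wind_of_mem_range _ hmem)⟩

/-- **Cylinder property of towers on bond-`ℤ²`** (one inclusion): if two configurations agree on a set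
of edges `M` containing every edge with medial point in `B(x, R) ∖ B̄(x, ρ)`, every loop of the first
surrounding `B̄(x, ρ)` inside `B(x, R)` is such a loop of the second. -/
theorem towerFamily_zEns_subset_of_agree {δ : ℝ} {ω ω' M : BondConfig (Site 2)} {x : ℂ} {ρ R : ℝ}
    (hM : ∀ e : MedialVertex, medialPoint δ e ∈ ball x R \ closedBall x ρ → e ∈ M)
    (hagree : ∀ e ∈ M, e ∈ ω ↔ e ∈ ω') :
    {u ∈ (zEns.X δ ω).loops | closedBall x ρ ⊆ {z | u.wind z ≠ 0} ∧ u.range ⊆ ball x R} ⊆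
      {u ∈ (zEns.X δ ω').loops | closedBall x ρ ⊆ {z | u.wind z ≠ 0} ∧ u.range ⊆ ball x R} := by
  rintro u ⟨hu, hwind, hrange⟩
  rw [loops_zEns_eq_image] at hu ⊢
  obtain ⟨k, hk, rfl⟩ := hu
  refine ⟨⟨k, ?_, rfl⟩, hwind, hrange⟩
  exact (isInterfaceLoop_congr fun e he ↦
    hagree e (hM e (medialPoint_mem_of_tower k.2 hwind hrange he))).1 hk

/-- **Cylinder property of towers on bond-`ℤ²`**: closing every edge off `M` (`ω ↦ ω ∩ M`), `M`
containing all edges with medial point in `B(x, R) ∖ B̄(x, ρ)`, does not change the family of loops of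
`X_δ(ω)` surrounding `B̄(x, ρ)` inside `B(x, R)`. -/
theorem towerFamily_zEns_inter (δ : ℝ) (ω M : BondConfig (Site 2)) (x : ℂ) (ρ R : ℝ)
    (hM : ∀ e : MedialVertex, medialPoint δ e ∈ ball x R \ closedBall x ρ → e ∈ M) :
    {u ∈ (zEns.X δ (ω ∩ M : BondConfig (Site 2))).loops |
        closedBall x ρ ⊆ {z | u.wind z ≠ 0} ∧ u.range ⊆ ball x R} =
      {u ∈ (zEns.X δ ω).loops | closedBall x ρ ⊆ {z | u.wind z ≠ 0} ∧ u.range ⊆ ball x R} :=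
  Set.Subset.antisymm
    (towerFamily_zEns_subset_of_agree hM fun _ he ↦ ⟨fun h ↦ h.1, fun h ↦ ⟨h, he⟩⟩)
    (towerFamily_zEns_subset_of_agree hM fun _ he ↦ ⟨fun h ↦ ⟨h, he⟩, fun h ↦ h.1⟩)

/-- **The tower count on bond-`ℤ²` is determined by the edges with midpoint in the window annulus.** -/
theorem towerCount_zEns_inter (δ : ℝ) (ω M : BondConfig (Site 2)) (x : ℂ) (ρ R : ℝ)
    (hM : ∀ e : MedialVertex, medialPoint δ e ∈ ball x R \ closedBall x ρ → e ∈ M) :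
    towerCount (zEns.X δ (ω ∩ M : BondConfig (Site 2))) x ρ R = towerCount (zEns.X δ ω) x ρ R := by
  unfold towerCount
  rw [towerFamily_zEns_inter δ ω M x ρ R hM]

/-- **The tower count on bond-`ℤ²` is measurable for the coordinate σ-algebra `⨆ e ∈ M, σ(e ∈ ·)` of any
edge set `M` containing the edges with midpoint in the window annulus.** -/
theorem measurable_towerCount_zEns_coord (δ : ℝ) (M : BondConfig (Site 2)) (x : ℂ) (ρ R : ℝ)
    (hM : ∀ e : MedialVertex, medialPoint δ e ∈ ball x R \ closedBall x ρ → e ∈ M) :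
    Measurable[⨆ e ∈ M, MeasurableSpace.comap (fun ω : BondConfig (Site 2) ↦ e ∈ ω) inferInstance]
      fun ω : BondConfig (Site 2) ↦ towerCount (zEns.X δ ω) x ρ R := by
  rw [show (fun ω : BondConfig (Site 2) ↦ towerCount (zEns.X δ ω) x ρ R) =
      (fun ω : BondConfig (Site 2) ↦ towerCount (zEns.X δ ω) x ρ R) ∘ fun ω ↦ ω ∩ M from
    funext fun ω ↦ (towerCount_zEns_inter δ ω M x ρ R hM).symm]
  exact (measurable_towerCount zEns zEns_mem δ x ρ R).comp (measurable_inter_coord M)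

/-- **Observables of bond-`ℤ²` determined by disjoint edge sets are independent** (bond analogue of the
site lemma `indepFun_of_determined`; product measure, `indep_coord`). -/
theorem indepFun_of_determined_zEns {M M' : BondConfig (Site 2)} (hMM' : Disjoint M M')
    {β γ : Type*} [MeasurableSpace β] [MeasurableSpace γ] {φ : BondConfig (Site 2) → β}
    {ψ : BondConfig (Site 2) → γ} (hφm : Measurable φ) (hψm : Measurable ψ)
    (hφ : ∀ ω, φ (ω ∩ M) = φ ω) (hψ : ∀ ω, ψ (ω ∩ M') = ψ ω) : IndepFun φ ψ zEns.P := by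
  have h₁ : Measurable[⨆ e ∈ M, MeasurableSpace.comap (fun ω : BondConfig (Site 2) ↦ e ∈ ω)
      inferInstance] φ := by
    rw [show φ = φ ∘ fun ω ↦ ω ∩ M from funext fun ω ↦ (hφ ω).symm]
    exact hφm.comp (measurable_inter_coord M)
  have h₂ : Measurable[⨆ e ∈ M', MeasurableSpace.comap (fun ω : BondConfig (Site 2) ↦ e ∈ ω)
      inferInstance] ψ := by
    rw [show ψ = ψ ∘ fun ω ↦ ω ∩ M' from funext fun ω ↦ (hψ ω).symm]
    exact hψm.comp (measurable_inter_coord M')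
  rw [IndepFun_iff_Indep]
  exact indep_of_indep_of_le_right
    (indep_of_indep_of_le_left (indep_coord (zdGraph 2) half hMM') h₁.comap_le) h₂.comap_le

/-- **Independence of tower counts of windows with disjoint midpoint annuli on bond-`ℤ²`** (every mesh,
no margin: each edge is read by at most one of the two towers). -/
theorem indepFun_towerCount_zEns (δ : ℝ) {x x' : ℂ} {ρ R ρ' R' : ℝ}
    (h : Disjoint (ball x R \ closedBall x ρ) (ball x' R' \ closedBall x' ρ')) :
    IndepFun (fun ω ↦ towerCount (zEns.X δ ω) x ρ R) (fun ω ↦ towerCount (zEns.X δ ω) x' ρ' R')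
      zEns.P :=
  indepFun_of_determined_zEns (M := {e : MedialVertex | medialPoint δ e ∈ ball x R \ closedBall x ρ})
    (M' := {e : MedialVertex | medialPoint δ e ∈ ball x' R' \ closedBall x' ρ'})
    (Set.disjoint_left.2 fun _ he he' ↦ Set.disjoint_left.1 h he he')
    (measurable_towerCount zEns zEns_mem δ x ρ R) (measurable_towerCount zEns zEns_mem δ x' ρ' R')
    (fun ω ↦ towerCount_zEns_inter δ ω _ x ρ R fun _ he ↦ he)
    (fun ω ↦ towerCount_zEns_inter δ ω _ x' ρ' R' fun _ he ↦ he)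

/-! ## §2 Site-`𝕋`: the tower of a window reads only the sites drawn in the thickened annulus -/

/-- The sites read by a closed honeycomb walk whose drawn loop (mesh `δ ≥ 0`) surrounds `B̄(x, ρ)` and
has trace in `B(x, R)` are drawn in the thickened annulus `B(x, R + δ) ∖ B̄(x, ρ − δ)`: the centre of the
tail face of each dart is on the trace (in the window, winding number `0`) and both endpoints of the
crossed `𝕋`-dart are within `δ` of it. -/
theorem triMeshPoint_mem_of_tower {δ : ℝ} (hδ : 0 ≤ δ) {v : HexVertex} {γ : hexGraph.Walk v v}
    {x : ℂ} {ρ R : ℝ}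
    (hwind : closedBall x ρ ⊆
      {z | (UnbasedLoop.mk (BasedLoop.mk (siteLoopCurve δ γ) (isLoop_siteLoopCurve δ γ))).wind z ≠ 0})
    (hrange : (UnbasedLoop.mk (BasedLoop.mk (siteLoopCurve δ γ) (isLoop_siteLoopCurve δ γ))).range ⊆
      ball x R)
    {d : hexGraph.Dart} (hd : d ∈ γ.darts) {e : triGraph.Dart}
    (he : triEdgeFaces e = (d.snd, d.fst)) :
    triMeshPoint δ e.fst ∈ ball x (R + δ) \ closedBall x (ρ - δ) ∧
      triMeshPoint δ e.snd ∈ ball x (R + δ) \ closedBall x (ρ - δ) := by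
  set u := UnbasedLoop.mk (BasedLoop.mk (siteLoopCurve δ γ) (isLoop_siteLoopCurve δ γ)) with hu
  have hp : (δ : ℂ) * hexCenter d.fst ∈ u.range := by
    rw [hu, UnbasedLoop.range_mk, BasedLoop.toCurveClass_mk]
    change (δ : ℂ) * hexCenter d.fst ∈ Set.range (γ.toCurve fun w ↦ (δ : ℂ) * hexCenter w)
    exact SimpleGraph.Walk.mem_range_toCurve _ γ (γ.dart_fst_mem_support_of_mem_darts hd)
  have hpR : dist ((δ : ℂ) * hexCenter d.fst) x < R := mem_ball.1 (hrange hp)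
  have hpρ : ρ < dist ((δ : ℂ) * hexCenter d.fst) x :=
    not_le.1 fun hle ↦ hwind (mem_closedBall.2 hle) (unbasedLoop_wind_of_mem_range u hp)
  have h2 : (triEdgeFaces e).2 = d.fst := by rw [he]
  have hfst : dist ((δ : ℂ) * hexCenter d.fst) (triMeshPoint δ e.fst) ≤ δ := by
    have := (hexCenter_triEdgeFaces_mem_closedBall hδ e).2
    rwa [h2, mem_closedBall] at this
  have hsnd : dist ((δ : ℂ) * hexCenter d.fst) (triMeshPoint δ e.snd) ≤ δ := by
    have := (hexCenter_triEdgeFaces_mem_closedBall hδ e.symm).1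
    rwa [triEdgeFaces_symm_holds e, Prod.fst_swap, h2, mem_closedBall] at this
  have key : ∀ q : ℂ, dist ((δ : ℂ) * hexCenter d.fst) q ≤ δ →
      q ∈ ball x (R + δ) \ closedBall x (ρ - δ) := fun q hq ↦ by
    have h₁ := dist_triangle_left q x ((δ : ℂ) * hexCenter d.fst)
    have h₂ := dist_triangle ((δ : ℂ) * hexCenter d.fst) q x
    exact ⟨mem_ball.2 (by linarith), fun hq' ↦ by linarith [mem_closedBall.1 hq']⟩
  exact ⟨key _ hfst, key _ hsnd⟩

/-- **Cylinder property of towers on site-`𝕋`** (one inclusion): if two configurations agree on a set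
of sites `S` containing every site drawn in `B(x, R + δ) ∖ B̄(x, ρ − δ)` (`δ ≥ 0`), every loop of the first
surrounding `B̄(x, ρ)` inside `B(x, R)` is such a loop of the second. -/
theorem towerFamily_tEns_subset_of_agree {δ : ℝ} (hδ : 0 ≤ δ) {ω ω' S : SiteConfig (Site 2)} {x : ℂ}
    {ρ R : ℝ} (hS : ∀ s : Site 2, triMeshPoint δ s ∈ ball x (R + δ) \ closedBall x (ρ - δ) → s ∈ S)
    (hagree : ∀ s ∈ S, s ∈ ω ↔ s ∈ ω') :
    {u ∈ (tEns.X δ ω).loops | closedBall x ρ ⊆ {z | u.wind z ≠ 0} ∧ u.range ⊆ ball x R} ⊆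
      {u ∈ (tEns.X δ ω').loops | closedBall x ρ ⊆ {z | u.wind z ≠ 0} ∧ u.range ⊆ ball x R} := by
  rintro u ⟨hu, hwind, hrange⟩
  rw [loops_tEns_eq_image] at hu ⊢
  obtain ⟨k, hk, rfl⟩ := hu
  refine ⟨⟨k, ?_, rfl⟩, hwind, hrange⟩
  refine (isSiteInterfaceLoop_congr_of_darts fun d hd e he ↦ ?_).1 hk
  obtain ⟨h₁, h₂⟩ := triMeshPoint_mem_of_tower hδ hwind hrange hd he
  exact ⟨hagree _ (hS _ h₁), hagree _ (hS _ h₂)⟩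

/-- **Cylinder property of towers on site-`𝕋`**: closing every site off `S` (`ω ↦ ω ∩ S`), `S` containing
all sites drawn in `B(x, R + δ) ∖ B̄(x, ρ − δ)`, does not change the family of loops of `X_δ(ω)`
surrounding `B̄(x, ρ)` inside `B(x, R)`. -/
theorem towerFamily_tEns_inter {δ : ℝ} (hδ : 0 ≤ δ) (ω S : SiteConfig (Site 2)) (x : ℂ) (ρ R : ℝ)
    (hS : ∀ s : Site 2, triMeshPoint δ s ∈ ball x (R + δ) \ closedBall x (ρ - δ) → s ∈ S) :
    {u ∈ (tEns.X δ (ω ∩ S : SiteConfig (Site 2))).loops |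
        closedBall x ρ ⊆ {z | u.wind z ≠ 0} ∧ u.range ⊆ ball x R} =
      {u ∈ (tEns.X δ ω).loops | closedBall x ρ ⊆ {z | u.wind z ≠ 0} ∧ u.range ⊆ ball x R} :=
  Set.Subset.antisymm
    (towerFamily_tEns_subset_of_agree hδ hS fun _ hs ↦ ⟨fun h ↦ h.1, fun h ↦ ⟨h, hs⟩⟩)
    (towerFamily_tEns_subset_of_agree hδ hS fun _ hs ↦ ⟨fun h ↦ ⟨h, hs⟩, fun h ↦ h.1⟩)

/-- **The tower count on site-`𝕋` is determined by the sites drawn in the thickened window annulus.** -/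
theorem towerCount_tEns_inter {δ : ℝ} (hδ : 0 ≤ δ) (ω S : SiteConfig (Site 2)) (x : ℂ) (ρ R : ℝ)
    (hS : ∀ s : Site 2, triMeshPoint δ s ∈ ball x (R + δ) \ closedBall x (ρ - δ) → s ∈ S) :
    towerCount (tEns.X δ (ω ∩ S : SiteConfig (Site 2))) x ρ R = towerCount (tEns.X δ ω) x ρ R := by
  unfold towerCount
  rw [towerFamily_tEns_inter hδ ω S x ρ R hS]

/-- **The tower count on site-`𝕋` is measurable for the coordinate σ-algebra `⨆ s ∈ S, σ(s ∈ ·)` of any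
site set `S` containing the sites drawn in the thickened window annulus.** -/
theorem measurable_towerCount_tEns_coord {δ : ℝ} (hδ : 0 ≤ δ) (S : SiteConfig (Site 2)) (x : ℂ)
    (ρ R : ℝ) (hS : ∀ s : Site 2, triMeshPoint δ s ∈ ball x (R + δ) \ closedBall x (ρ - δ) → s ∈ S) :
    Measurable[⨆ s ∈ S, MeasurableSpace.comap (fun ω : SiteConfig (Site 2) ↦ s ∈ ω) inferInstance]
      fun ω : SiteConfig (Site 2) ↦ towerCount (tEns.X δ ω) x ρ R := by
  rw [show (fun ω : SiteConfig (Site 2) ↦ towerCount (tEns.X δ ω) x ρ R) =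
      (fun ω : SiteConfig (Site 2) ↦ towerCount (tEns.X δ ω) x ρ R) ∘ fun ω ↦ ω ∩ S from
    funext fun ω ↦ (towerCount_tEns_inter hδ ω S x ρ R hS).symm]
  exact (measurable_towerCount tEns tEns_mem δ x ρ R).comp (measurable_inter_of_subset S)

/-- **Observables of site-`𝕋` determined by disjoint site sets are independent under `tEns.P`**
(`indepFun_of_determined` at `tEns.P = sitePercolation (Site 2) half`). -/
theorem indepFun_of_determined_tEns {S S' : SiteConfig (Site 2)} (hSS' : Disjoint S S')
    {β γ : Type*} [MeasurableSpace β] [MeasurableSpace γ] {φ : SiteConfig (Site 2) → β}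
    {ψ : SiteConfig (Site 2) → γ} (hφm : Measurable φ) (hψm : Measurable ψ)
    (hφ : ∀ ω, φ (ω ∩ S) = φ ω) (hψ : ∀ ω, ψ (ω ∩ S') = ψ ω) : IndepFun φ ψ tEns.P :=
  indepFun_of_determined half hSS' hφm hψm hφ hψ

/-- **Independence of tower counts of windows with disjoint thickened annuli on site-`𝕋`** (mesh
`δ ≥ 0`). -/
theorem indepFun_towerCount_tEns {δ : ℝ} (hδ : 0 ≤ δ) {x x' : ℂ} {ρ R ρ' R' : ℝ}
    (h : Disjoint (ball x (R + δ) \ closedBall x (ρ - δ)) (ball x' (R' + δ) \ closedBall x' (ρ' - δ))) :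
    IndepFun (fun ω ↦ towerCount (tEns.X δ ω) x ρ R) (fun ω ↦ towerCount (tEns.X δ ω) x' ρ' R')
      tEns.P :=
  indepFun_of_determined_tEns
    (S := {s : Site 2 | triMeshPoint δ s ∈ ball x (R + δ) \ closedBall x (ρ - δ)})
    (S' := {s : Site 2 | triMeshPoint δ s ∈ ball x' (R' + δ) \ closedBall x' (ρ' - δ)})
    (Set.disjoint_left.2 fun _ hs hs' ↦ Set.disjoint_left.1 h hs hs')
    (measurable_towerCount tEns tEns_mem δ x ρ R) (measurable_towerCount tEns tEns_mem δ x' ρ' R')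
    (fun ω ↦ towerCount_tEns_inter hδ ω _ x ρ R fun _ hs ↦ hs)
    (fun ω ↦ towerCount_tEns_inter hδ ω _ x' ρ' R' fun _ hs ↦ hs)

end TowerIndependence

/-! ## §3 Both lattice ensembles -/

/-- **Independence of tower counts across disjoint annuli on BOTH lattice ensembles** (registered
helper toward stub R1' `stub_uvDecoupling`, line `ring-cloud-tomography` r4; the exact half of
quasi-multiplicativity).  For `E ∈ latticeEnsembles`, mesh `δ ≥ 0` and two windows `(x, ρ, R)`,
`(x', ρ', R')` whose `δ`-thickened annuli `B(x, R + δ) ∖ B̄(x, ρ − δ)`, `B(x', R' + δ) ∖ B̄(x', ρ' − δ)`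
are disjoint, the tower counts `N_x(ρ, R)` and `N_{x'}(ρ', R')` of `X_δ` are INDEPENDENT under `E.P`:
each is a cylinder function of the edges (sites) drawn in its own thickened annulus
(`TowerIndependence.towerCount_zEns_inter`, `…towerCount_tEns_inter`) and disjoint families of
coordinates of the product measures are independent. -/
theorem indepFun_towerCount_latticeEnsembles : ∀ E ∈ latticeEnsembles, ∀ {δ : ℝ}, 0 ≤ δ →
    ∀ {x x' : ℂ} {ρ R ρ' R' : ℝ},
    Disjoint (Metric.ball x (R + δ) \ Metric.closedBall x (ρ - δ))
      (Metric.ball x' (R' + δ) \ Metric.closedBall x' (ρ' - δ)) →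
    ProbabilityTheory.IndepFun (fun ω ↦ towerCount (E.X δ ω) x ρ R)
      (fun ω ↦ towerCount (E.X δ ω) x' ρ' R') E.P := by
  intro E hE δ hδ x x' ρ R ρ' R' h
  simp only [latticeEnsembles, Set.mem_insert_iff, Set.mem_singleton_iff] at hE
  rcases hE with rfl | rfl
  · -- the midpoint annuli lie in the thickened ones (`δ ≥ 0`)
    refine TowerIndependence.indepFun_towerCount_zEns δ (h.mono ?_ ?_)
    · exact fun z hz ↦ ⟨ball_subset_ball (by linarith) hz.1,
        fun h' ↦ hz.2 (closedBall_subset_closedBall (by linarith) h')⟩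
    · exact fun z hz ↦ ⟨ball_subset_ball (by linarith) hz.1,
        fun h' ↦ hz.2 (closedBall_subset_closedBall (by linarith) h')⟩
  · exact TowerIndependence.indepFun_towerCount_tEns hδ h

namespace TowerIndependence

/-- **Nested concentric annuli with a `2δ` gap carry independent tower counts** on both lattice
ensembles: `N_x(ρ, R)` and `N_x(ρ', R')` are independent under `E.P` as soon as `R' + 2δ ≤ ρ`. -/
theorem indepFun_towerCount_nested : ∀ E ∈ latticeEnsembles, ∀ {δ : ℝ}, 0 ≤ δ → ∀ (x : ℂ)
    {ρ R ρ' R' : ℝ}, R' + 2 * δ ≤ ρ →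
    IndepFun (fun ω ↦ towerCount (E.X δ ω) x ρ R) (fun ω ↦ towerCount (E.X δ ω) x ρ' R') E.P := by
  intro E hE δ hδ x ρ R ρ' R' hgap
  refine indepFun_towerCount_latticeEnsembles E hE hδ (Set.disjoint_left.2 fun z hz hz' ↦ ?_)
  have h₁ : ρ - δ < dist z x := not_le.1 fun h' ↦ hz.2 (mem_closedBall.2 h')
  have h₂ : dist z x < R' + δ := mem_ball.1 hz'.1
  linarith

/-- The same for the positively weighted powers `u^{N}`, `v^{N'}` (measurable images of independent
counts). -/
theorem indepFun_pow_towerCount_nested : ∀ E ∈ latticeEnsembles, ∀ {δ : ℝ}, 0 ≤ δ → ∀ (x : ℂ)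
    (u v : ℝ) {ρ R ρ' R' : ℝ}, R' + 2 * δ ≤ ρ →
    IndepFun (fun ω ↦ u ^ towerCount (E.X δ ω) x ρ R) (fun ω ↦ v ^ towerCount (E.X δ ω) x ρ' R')
      E.P :=
  fun E hE _ hδ x u v _ _ _ _ hgap ↦
    (indepFun_towerCount_nested E hE hδ x hgap).comp (measurable_of_countable fun n : ℕ ↦ u ^ n)
      (measurable_of_countable fun n : ℕ ↦ v ^ n)

/-- **Product formula for nested tower functionals**: `E_δ[u^{N_x(ρ,R)} v^{N_x(ρ',R')}] =
E_δ[u^{N_x(ρ,R)}] · E_δ[v^{N_x(ρ',R')}]` on both lattice ensembles when `R' + 2δ ≤ ρ`. -/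
theorem integral_pow_towerCount_mul_nested : ∀ E ∈ latticeEnsembles, ∀ {δ : ℝ}, 0 ≤ δ → ∀ (x : ℂ)
    (u v : ℝ) {ρ R ρ' R' : ℝ}, R' + 2 * δ ≤ ρ →
    ∫ ω, u ^ towerCount (E.X δ ω) x ρ R * v ^ towerCount (E.X δ ω) x ρ' R' ∂E.P =
      (∫ ω, u ^ towerCount (E.X δ ω) x ρ R ∂E.P) * ∫ ω, v ^ towerCount (E.X δ ω) x ρ' R' ∂E.P :=
  fun E hE δ hδ x u v ρ R ρ' R' hgap ↦
    (indepFun_pow_towerCount_nested E hE hδ x u v hgap).integral_fun_mul_eq_mul_integral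
      ((measurable_towerCount E hE δ x ρ R).const_pow u).aestronglyMeasurable
      ((measurable_towerCount E hE δ x ρ' R').const_pow v).aestronglyMeasurable

/-! ## §4 Exact sub- and super-multiplicativity of the tower moments -/

/-- The tower count is monotone in the window (for a finite bigger tower). -/
theorem towerCount_mono_window (c : LoopConfig ℂ) (x : ℂ) (ρ : ℝ) {R' R : ℝ} (h : R' ≤ R)
    (hfin : {u ∈ c.loops | closedBall x ρ ⊆ {z | u.wind z ≠ 0} ∧ u.range ⊆ ball x R}.Finite) :
    towerCount c x ρ R' ≤ towerCount c x ρ R :=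
  Set.ncard_le_ncard (fun _ hu ↦ ⟨hu.1, hu.2.1, hu.2.2.trans (ball_subset_ball h)⟩) hfin

/-- Pathwise comparison of the integrands for weights `u ≤ 1`:
`u^{N_0(ρ₁ρ₂,1)} ≤ u^{N_0(ρ₁,1)} · u^{N_0(ρ₁ρ₂,ρ₁')}` for `ρ₁' ≤ ρ₁` (super-additivity of the counts and
window monotonicity), on both lattice ensembles. -/
theorem pow_towerCount_le_mul : ∀ E ∈ latticeEnsembles, ∀ {δ : ℝ}, 0 < δ → ∀ (ω : E.Ω)
    {u ρ₁ ρ₁' ρ₂ : ℝ}, 0 ≤ u → u ≤ 1 → 0 ≤ ρ₁ → ρ₁ ≤ 1 → ρ₂ ≤ 1 → ρ₁' ≤ ρ₁ →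
    u ^ towerCount (E.X δ ω) 0 (ρ₁ * ρ₂) 1 ≤
      u ^ towerCount (E.X δ ω) 0 ρ₁ 1 * u ^ towerCount (E.X δ ω) 0 (ρ₁ * ρ₂) ρ₁' := by
  intro E hE δ hδ ω u ρ₁ ρ₁' ρ₂ hu0 hu1 h0 h1 h2 h'
  have hadd := ConeTilt.towerCount_add_le_latticeEnsembles E hE hδ ω h0 h1 h2
  have hmono : towerCount (E.X δ ω) 0 (ρ₁ * ρ₂) ρ₁' ≤ towerCount (E.X δ ω) 0 (ρ₁ * ρ₂) ρ₁ :=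
    towerCount_mono_window _ 0 _ h' (ConeTilt.finite_towerSet E hE hδ ω 0 _ _)
  calc u ^ towerCount (E.X δ ω) 0 (ρ₁ * ρ₂) 1
      ≤ u ^ (towerCount (E.X δ ω) 0 ρ₁ 1 + towerCount (E.X δ ω) 0 (ρ₁ * ρ₂) ρ₁) :=
        pow_le_pow_of_le_one hu0 hu1 hadd
    _ = u ^ towerCount (E.X δ ω) 0 ρ₁ 1 * u ^ towerCount (E.X δ ω) 0 (ρ₁ * ρ₂) ρ₁ := pow_add _ _ _
    _ ≤ u ^ towerCount (E.X δ ω) 0 ρ₁ 1 * u ^ towerCount (E.X δ ω) 0 (ρ₁ * ρ₂) ρ₁' :=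
        mul_le_mul_of_nonneg_left (pow_le_pow_of_le_one hu0 hu1 hmono) (pow_nonneg hu0 _)

/-- Pathwise comparison for weights `u ≥ 1` (reverse direction). -/
theorem mul_le_pow_towerCount : ∀ E ∈ latticeEnsembles, ∀ {δ : ℝ}, 0 < δ → ∀ (ω : E.Ω)
    {u ρ₁ ρ₁' ρ₂ : ℝ}, 1 ≤ u → 0 ≤ ρ₁ → ρ₁ ≤ 1 → ρ₂ ≤ 1 → ρ₁' ≤ ρ₁ →
    u ^ towerCount (E.X δ ω) 0 ρ₁ 1 * u ^ towerCount (E.X δ ω) 0 (ρ₁ * ρ₂) ρ₁' ≤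
      u ^ towerCount (E.X δ ω) 0 (ρ₁ * ρ₂) 1 := by
  intro E hE δ hδ ω u ρ₁ ρ₁' ρ₂ hu1 h0 h1 h2 h'
  have hadd := ConeTilt.towerCount_add_le_latticeEnsembles E hE hδ ω h0 h1 h2
  have hmono : towerCount (E.X δ ω) 0 (ρ₁ * ρ₂) ρ₁' ≤ towerCount (E.X δ ω) 0 (ρ₁ * ρ₂) ρ₁ :=
    towerCount_mono_window _ 0 _ h' (ConeTilt.finite_towerSet E hE hδ ω 0 _ _)
  calc u ^ towerCount (E.X δ ω) 0 ρ₁ 1 * u ^ towerCount (E.X δ ω) 0 (ρ₁ * ρ₂) ρ₁'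
      ≤ u ^ towerCount (E.X δ ω) 0 ρ₁ 1 * u ^ towerCount (E.X δ ω) 0 (ρ₁ * ρ₂) ρ₁ :=
        mul_le_mul_of_nonneg_left (pow_le_pow_right₀ hu1 hmono) (pow_nonneg (by linarith) _)
    _ = u ^ (towerCount (E.X δ ω) 0 ρ₁ 1 + towerCount (E.X δ ω) 0 (ρ₁ * ρ₂) ρ₁) := (pow_add _ _ _).symm
    _ ≤ u ^ towerCount (E.X δ ω) 0 (ρ₁ * ρ₂) 1 := pow_le_pow_right₀ hu1 hadd

/-- **Exact sub-multiplicativity of the tower moments** (weights `0 ≤ u ≤ 1`, both lattice ensembles):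
for `0 ≤ ρ₁ ≤ 1`, `ρ₂ ≤ 1`, mesh `δ > 0` and an inner window `ρ₁'` with `ρ₁' + 2δ ≤ ρ₁`,
`E_δ[u^{N_0(ρ₁ρ₂,1)}] ≤ E_δ[u^{N_0(ρ₁,1)}] · E_δ[u^{N_0(ρ₁ρ₂,ρ₁')}]` — super-additivity of the counts,
window monotonicity, and independence across the two annuli. -/
theorem towerMoment_le_mul : ∀ E ∈ latticeEnsembles, ∀ {δ : ℝ}, 0 < δ → ∀ {u ρ₁ ρ₁' ρ₂ : ℝ},
    0 ≤ u → u ≤ 1 → 0 ≤ ρ₁ → ρ₁ ≤ 1 → ρ₂ ≤ 1 → ρ₁' + 2 * δ ≤ ρ₁ →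
    E.towerMoment u δ (ρ₁ * ρ₂) ≤
      E.towerMoment u δ ρ₁ * ∫ ω, u ^ towerCount (E.X δ ω) 0 (ρ₁ * ρ₂) ρ₁' ∂E.P := by
  intro E hE δ hδ u ρ₁ ρ₁' ρ₂ hu0 hu1 h0 h1 h2 hgap
  have hind := indepFun_pow_towerCount_nested E hE hδ.le 0 u u (R := 1) (ρ' := ρ₁ * ρ₂) hgap
  rw [LoopEnsemble.towerMoment, LoopEnsemble.towerMoment,
    ← integral_pow_towerCount_mul_nested E hE hδ.le 0 u u hgap]
  exact integral_mono (integrable_pow_towerCount E hE u δ 0 _ 1 hu0 hu1)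
    (hind.integrable_mul (integrable_pow_towerCount E hE u δ 0 _ _ hu0 hu1)
      (integrable_pow_towerCount E hE u δ 0 _ _ hu0 hu1))
    fun ω ↦ pow_towerCount_le_mul E hE hδ ω hu0 hu1 h0 h1 h2 (by linarith)

/-- **Exact super-multiplicativity of the tower moments** (weights `u ≥ 1`, both lattice ensembles;
the cone needs `w(t) ∈ (1, √3)` for `t < 0`): under the same hypotheses,
`E_δ[u^{N_0(ρ₁,1)}] · E_δ[u^{N_0(ρ₁ρ₂,ρ₁')}] ≤ E_δ[u^{N_0(ρ₁ρ₂,1)}]`. -/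
theorem mul_le_towerMoment : ∀ E ∈ latticeEnsembles, ∀ {δ : ℝ}, 0 < δ → ∀ {u ρ₁ ρ₁' ρ₂ : ℝ},
    1 ≤ u → 0 ≤ ρ₁ → ρ₁ ≤ 1 → ρ₂ ≤ 1 → ρ₁' + 2 * δ ≤ ρ₁ →
    E.towerMoment u δ ρ₁ * ∫ ω, u ^ towerCount (E.X δ ω) 0 (ρ₁ * ρ₂) ρ₁' ∂E.P ≤
      E.towerMoment u δ (ρ₁ * ρ₂) := by
  intro E hE δ hδ u ρ₁ ρ₁' ρ₂ hu1 h0 h1 h2 hgap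
  have hu0 : 0 ≤ u := by linarith
  have hind := indepFun_pow_towerCount_nested E hE hδ.le 0 u u (R := 1) (ρ' := ρ₁ * ρ₂) hgap
  rw [LoopEnsemble.towerMoment, LoopEnsemble.towerMoment,
    ← integral_pow_towerCount_mul_nested E hE hδ.le 0 u u hgap]
  exact integral_mono
    (hind.integrable_mul (ConeTilt.integrable_pow_towerCount_of_nonneg E hE u hδ 0 _ _ hu0)
      (ConeTilt.integrable_pow_towerCount_of_nonneg E hE u hδ 0 _ _ hu0))
    (ConeTilt.integrable_pow_towerCount_of_nonneg E hE u hδ 0 _ 1 hu0)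
    fun ω ↦ mul_le_pow_towerCount E hE hδ ω hu1 h0 h1 h2 (by linarith)

end TowerIndependence

end Summit.CriticalPhenomena.CardyFormulaZ2.Cruxes.NestingRigidity.RingCloudTomography

end
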